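import Summits.Ventures.PercRepro.S2CobasisSix
import Summits.Ventures.PercRepro.S2PaymentTop
import Summits.Ventures.PercRepro.S2TopSevenCharge

/-!
# PercRepro — S2: THE TOP COUNT AT CORANK `7` THROUGH ITS `5`-, `6`- AND `7`-SETS (p7, gen 14; sub-claim S2; the spread case of `(14, 7)`)

* **`ncard_top_six_le_n`** — the top `6`-sets (`ρ = 5`, complement spanning) by the smallest circuit inside them, on a
  ground set of `n` points: `≤ s₃ · c + s₄ · C(n − 4, 2) + s₅ · (n − 5) + s₆` with a per-triangle charge `c`
  (g12's `S2.ncard_top_six_le` with the corank `6` replaced by `n`).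
* **`topCount_mul_five_le_seven`** — at corank `7`, `5 · topCount ≤ 5 · #{top 5-sets} + 7 · #{top 6-sets}`: a top set has
  `5`, `6` or `7` points, and `5 · #{top 7-sets} ≤ 2 · #{top 6-sets}` (`S2.ncard_top_seven_mul_five_le`) when rank-`5`
  sets have `≤ 8` points. Axioms: standard.
-/

open scoped Matroid

namespace PercRepro

namespace S2

open Set

variable {α : Type}

/-- **The top `6`-sets by their smallest circuit** on `n` points, with a per-triangle charge `t`. -/
theorem ncard_top_six_le_n (M : Matroid α) [M.Finite] {n : ℕ} (hn : M.E.ncard = n)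
    (hcirc : ∀ C, M.IsCircuit C → 3 ≤ C.encard) (t : ℕ)
    (htri : ∀ T : Set α, M.IsCircuit T → T.ncard = 3 →
      {B : Set α | B ⊆ M.E ∧ B.ncard = 6 ∧ T ⊆ B ∧ M.eRk (M.E \ B) = M.eRank}.ncard ≤ t) :
    {B : Set α | B ⊆ M.E ∧ B.ncard = 6 ∧ M.eRk B = 5 ∧ M.eRk (M.E \ B) = M.eRank}.ncard ≤
      {C : Set α | M.IsCircuit C ∧ C.ncard = 3}.ncard * t +
      {C : Set α | M.IsCircuit C ∧ C.ncard = 4}.ncard * (n - 4).choose 2 +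
      {C : Set α | M.IsCircuit C ∧ C.ncard = 5}.ncard * (n - 5) +
      {C : Set α | M.IsCircuit C ∧ C.ncard = 6}.ncard := by
  classical
  set Top := {B : Set α | B ⊆ M.E ∧ B.ncard = 6 ∧ M.eRk B = 5 ∧ M.eRk (M.E \ B) = M.eRank} with hTop
  let A : ℕ → Set (Set α) := fun k => ⋃ C ∈ Matroid.circF M k,
    {B : Set α | B ⊆ M.E ∧ B.ncard = 6 ∧ C ⊆ B ∧ M.eRk (M.E \ B) = M.eRank}
  -- every top `6`-set contains a circuit of `3 … 6` points
  have hcover : Top ⊆ A 3 ∪ A 4 ∪ A 5 ∪ A 6 := by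
    rintro B ⟨hBE, hB6, hB5, hBs⟩
    have hBfin : B.Finite := M.ground_finite.subset hBE
    have hD : M.Dep B := by
      rw [← Matroid.eRk_lt_encard_iff_dep_of_finite hBfin hBE, hB5, ← hBfin.cast_ncard_eq, hB6]
      norm_num
    obtain ⟨C, hCB, hC⟩ := hD.exists_isCircuit_subset
    have hCfin : C.Finite := hBfin.subset hCB
    have hC3 : 3 ≤ C.ncard := by
      have := hcirc C hC
      rw [← hCfin.cast_ncard_eq] at this
      exact_mod_cast this
    have hC6 : C.ncard ≤ 6 := by
      have := Set.ncard_le_ncard hCB hBfin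
      omega
    have hmem : ∀ k, C.ncard = k → B ∈ A k := by
      intro k hk
      exact Set.mem_iUnion₂.2 ⟨C, Matroid.mem_circF.2 ⟨hC, hk⟩, hBE, hB6, hCB, hBs⟩
    rcases (show C.ncard = 3 ∨ C.ncard = 4 ∨ C.ncard = 5 ∨ C.ncard = 6 by omega) with h | h | h | h
    · exact Or.inl (Or.inl (Or.inl (hmem 3 h)))
    · exact Or.inl (Or.inl (Or.inr (hmem 4 h)))
    · exact Or.inl (Or.inr (hmem 5 h))
    · exact Or.inr (hmem 6 h)
  have hAfin : ∀ k, (A k).Finite := fun k =>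
    M.ground_finite.finite_subsets.subset (fun B hB => by
      obtain ⟨C, -, hB⟩ := Set.mem_iUnion₂.1 hB
      exact hB.1)
  -- each `A k` by the union bound over the `k`-circuits
  have hAk : ∀ k (b : ℕ), (∀ C, M.IsCircuit C → C.ncard = k →
      {B : Set α | B ⊆ M.E ∧ B.ncard = 6 ∧ C ⊆ B ∧ M.eRk (M.E \ B) = M.eRank}.ncard ≤ b) →
      (A k).ncard ≤ {C : Set α | M.IsCircuit C ∧ C.ncard = k}.ncard * b := by
    intro k b hb
    calc (A k).ncard ≤ ∑ C ∈ Matroid.circF M k,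
          {B : Set α | B ⊆ M.E ∧ B.ncard = 6 ∧ C ⊆ B ∧ M.eRk (M.E \ B) = M.eRank}.ncard :=
          Finset.set_ncard_biUnion_le (Matroid.circF M k) _
      _ ≤ ∑ _C ∈ Matroid.circF M k, b := by
          refine Finset.sum_le_sum (fun C hC => ?_)
          obtain ⟨hCc, hCk⟩ := Matroid.mem_circF.1 hC
          exact hb C hCc hCk
      _ = {C : Set α | M.IsCircuit C ∧ C.ncard = k}.ncard * b := by
          rw [Finset.sum_const, smul_eq_mul, Matroid.card_circF]
  have hsup : ∀ k (C : Set α), M.IsCircuit C → C.ncard = k →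
      {B : Set α | B ⊆ M.E ∧ B.ncard = 6 ∧ C ⊆ B ∧ M.eRk (M.E \ B) = M.eRank}.ncard ≤
        (n - k).choose (6 - k) := by
    intro k C hC hCk
    have h := ncard_subsets_superset_le M hC.subset_ground 6
    rw [hn, hCk] at h
    refine le_trans (Set.ncard_le_ncard ?_ (M.ground_finite.finite_subsets.subset (fun X hX => hX.1))) h
    rintro B ⟨hBE, hB6, hCB, -⟩
    exact ⟨hBE, hB6, hCB⟩
  have h3 := hAk 3 t (fun C hC hCk => htri C hC hCk)
  have h4 := hAk 4 ((n - 4).choose 2) (fun C hC hCk => hsup 4 C hC hCk)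
  have h5 := hAk 5 ((n - 5).choose 1) (fun C hC hCk => hsup 5 C hC hCk)
  have h6 := hAk 6 ((n - 6).choose 0) (fun C hC hCk => hsup 6 C hC hCk)
  rw [Nat.choose_one_right] at h5
  rw [Nat.choose_zero_right, mul_one] at h6
  have hu := Set.ncard_le_ncard hcover (((hAfin 3).union (hAfin 4)).union (hAfin 5) |>.union (hAfin 6))
  have hu1 := Set.ncard_union_le (A 3 ∪ A 4 ∪ A 5) (A 6)
  have hu2 := Set.ncard_union_le (A 3 ∪ A 4) (A 5)
  have hu3 := Set.ncard_union_le (A 3) (A 4)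
  omega

/-- **The top count at corank `7` through the top `5`- and `6`-sets**: `5 · topCount ≤ 5 · #top5 + 7 · #top6`. -/
theorem topCount_mul_five_le_seven (M : Matroid α) [M.Finite] {p : ℕ} (hR : M.eRank = (p : ℕ∞))
    (hd : M.E.encard = M.eRank + ((7 : ℕ) : ℕ∞))
    (hC1 : ∀ L ⊆ M.E, M.eRk L = 2 → L.ncard ≤ 3)
    (hflat : ∀ X ⊆ M.E, M.eRk X ≤ 5 → X.ncard ≤ 8) :
    Matroid.topCount M p 5 * 5 ≤
      {B : Set α | B ⊆ M.E ∧ B.ncard = 5 ∧ M.eRk B = 5 ∧ M.eRk (M.E \ B) = M.eRank}.ncard * 5 +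
      {B : Set α | B ⊆ M.E ∧ B.ncard = 6 ∧ M.eRk B = 5 ∧ M.eRk (M.E \ B) = M.eRank}.ncard * 7 := by
  classical
  have hU1 := topCount_le_ncard_compl_spanning (M := M) hR hd 5
  simp only [Nat.cast_ofNat] at hU1
  have hfin : ∀ (k : ℕ), {B : Set α | B ⊆ M.E ∧ B.ncard = k ∧ M.eRk B = 5 ∧ M.eRk (M.E \ B) = M.eRank}.Finite :=
    fun _ => M.ground_finite.finite_subsets.subset (fun B hB => hB.1)
  have hsplit : {B : Set α | B ⊆ M.E ∧ M.eRk B = 5 ∧ B.ncard ≤ 7 ∧ M.eRk (M.E \ B) = M.eRank}.ncard ≤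
      {B : Set α | B ⊆ M.E ∧ B.ncard = 5 ∧ M.eRk B = 5 ∧ M.eRk (M.E \ B) = M.eRank}.ncard +
      {B : Set α | B ⊆ M.E ∧ B.ncard = 6 ∧ M.eRk B = 5 ∧ M.eRk (M.E \ B) = M.eRank}.ncard +
      {B : Set α | B ⊆ M.E ∧ B.ncard = 7 ∧ M.eRk B = 5 ∧ M.eRk (M.E \ B) = M.eRank}.ncard := by
    refine le_trans (Set.ncard_le_ncard ?_ (((hfin 5).union (hfin 6)).union (hfin 7))) ?_
    · rintro B ⟨hBE, hB5, hB7, hBs⟩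
      have hBfin : B.Finite := M.ground_finite.subset hBE
      have h5le : 5 ≤ B.ncard := by
        have := M.eRk_le_encard B
        rw [hB5, ← hBfin.cast_ncard_eq] at this
        exact_mod_cast this
      rcases (show B.ncard = 5 ∨ B.ncard = 6 ∨ B.ncard = 7 by omega) with h | h | h
      · exact Or.inl (Or.inl ⟨hBE, h, hB5, hBs⟩)
      · exact Or.inl (Or.inr ⟨hBE, h, hB5, hBs⟩)
      · exact Or.inr ⟨hBE, h, hB5, hBs⟩
    · exact (Set.ncard_union_le _ _).trans (Nat.add_le_add_right (Set.ncard_union_le _ _) _)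
  have hcharge := ncard_top_seven_mul_five_le M hC1 hflat
  omega

end S2

end PercRepro
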